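import Literature.MathematicalPhysics.QuantumFieldTheory.Balaban1983to89.B9Thm37CubeCoverCommutators

/-!
# NODE 00 — the GENUINE LOCAL CUBE INVERSES `G′_□(U)` of [B9] pp. 408–409 ∕ (3.87) at def-Y's letters (walk-letter instance, FILE A-0)

[B9] p. 408 L35 – p. 409 L6: *"Let us take a cube `□ ∈ 𝒟_j` and let us define a sequence `{Ω_n(□)}_{n=0,…,j+1}` of domains … The operators
constructed for this sequence, which we denote by `G′_□(U)`, `C_□(U) = (Q′(U)G′_□²(U)Q′*(U))⁻¹`, `G_□(U)`, satisfy all the inequalities of Theorems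
3.1–3.3 correspondingly"* (the propagators of a sequence of domains are those of (3.24)–(3.25), pp. 394–395); p. 409 L12, (3.87):
*"`G′₀ = Σ_{□∈𝒟} h_□ G′_□ h_□`"*; p. 409 L17–20, (3.88) and the display after it (= [4] (2.38) p. 229): *"`Δ′_a G′₀ = I − Σ_□ K(h_□) G′_□ h_□ = I − R′`"*.
(Edition 2: citation LOCATORS corrected after the referee's read — «(3.79) p. 406» is the `F₂(B)B` bound, not `G′_□`; no declaration changed.)
(Edition 3: «(3.25)» ∕ «(3.23)» and `G′ = (Δ′_a)⁻¹` are printed on p. 394 (the page owner's read); locators only, no declaration changed.)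

n06-l's `B9Thm37CubeCoverCommutators` (M5.7) proves (3.88) at def-Y's genuine `Δ′_a(U)` (`eq388_deltaPrimeAY`) for ANY family of cube
operators `Gl c` carrying the LOCAL-INVERSE PROPERTY `h_c Δ′_a(U) G_c h_c = h_c²` as a HYPOTHESIS («the content of modules M5.1a ∕ M5.2»).
This module CONSTRUCTS the cube operators at def-Y's letters and DISCHARGES that hypothesis from invertibility alone:

* §1 (any ring; the `Ring.inverse`, 𝔸-valued twin of dag-n15-c's real-scalar `dirOp` ∕ `cubeInv` «folklore» §1 of
  `Summit…BalabanUVNodesN15TwoSpacingGluingDirichlet`, which lives in the Theorems lane and reads `(X → ℝ)`) the PADDED COMPRESSION `dirPadY P T := P T P + (1 − P)` of `T` by an idempotent `P` and the LOCAL INVERSE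
  `dirInvY P T := P (dirPadY P T)⁻¹ P` (`Ring.inverse`: the inverse where `dirPadY P T` is a unit, `0` elsewhere — def-Y's `GpY` convention):
  `P T P · dirInvY P T = P = dirInvY P T · P T P` under `IsUnit (dirPadY P T)`, support `P · dirInvY = dirInvY = dirInvY · P`, congruence in `P T P`;
* §2 (def-Y's site sector) the cube projection `cubeProjY i D := M_{𝟙_D}` (`cutMulY` of the indicator of a site set `D` = □̃), and
  ★★ `GsqY i par D : SiteOpY 𝔸 i := fun U => dirInvY (cubeProjY i D) (Δ′_a(U))` — `G′_□(U)` = the inverse of `Δ′_a(U)` compressed to the functions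
  supported in □̃ (Dirichlet data outside □̃), extended by `0`; supported in `D` on both sides; ★★ the local-inverse property
  `h Δ′_a(U) G′_□(U) h = h²` for every cut-off `h` supported in `D`, under `IsUnit (padDeltaY i par D U)` (the regime's positivity of
  `Δ′_a(U)` on □̃ — Thm 3.1 ∕ (3.36); a HYPOTHESIS, never asserted); hence ★ (3.88) and the fixed point (3.90) AT THE GENUINE LOCAL INVERSES
  (`eq388_GsqY`, `fixedPoint388_GsqY`); locality in `U` as a congruence (`GsqY_congr`: `G′_□(U)` depends on `U` only through `P Δ′_a(U) P`);
  the whole-lattice face `GsqY i par univ = GpY i par`;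
* §3 the SUPPORT HALF of locality for an abstract transporter: `Δ′_a(U)λ(z)` reads `U` only at the bonds of `z` and through the block
  transporters of the averaging pairs at `z` (`deltaPrimeAY_apply_congr_of_agree`) ⇒ ★★ `GsqY_congr_of_agree` (the `Locality.gsq` shape).

Gauge group SU(N) only through def-Y's carriers; no continuum limit, no OS axioms, no mass gap, no claim on the Clay problem.
-/

namespace Literature.MathematicalPhysics.QuantumFieldTheory.Balaban1983to89.Node00.OpsYLocalInverse

open B6KLevelCensusIndexV1 (KIdx)
open B9Thm37CubeCoverCommutators (cutMulY cutMulY_apply cutMulY_mul cutMulY_one KhY eq388_deltaPrimeAY fixedPoint388_deltaPrimeAY)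

/-! ## §1 The padded compression by an idempotent and its inverse (any ring) -/

section Ring

variable {A : Type} [Ring A]

/-- the PADDED COMPRESSION `P T P + (1 − P)` of `T` by `P`: a unit of the ring iff `P T P` is invertible on the range of the idempotent `P`.
[cite: Balaban1985BackgroundPropagators, pp.408–409 (G′_□), dictionary] -/
def dirPadY (P T : A) : A := P * T * P + (1 - P)

/-- the LOCAL INVERSE `P (P T P + 1 − P)⁻¹ P` (`Ring.inverse`: `0` when the padded compression is not a unit).
[cite: Balaban1985BackgroundPropagators, pp.408–409 (G′_□), dictionary] -/
noncomputable def dirInvY (P T : A) : A := P * Ring.inverse (dirPadY P T) * P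

/-- congruence: the local inverse depends on `T` only through the compression `P T P`. [cite: Balaban1985BackgroundPropagators, pp.408–409 (G′_□), bookkeeping] -/
theorem dirInvY_congr {P T T' : A} (h : P * T * P = P * T' * P) : dirInvY P T = dirInvY P T' := by
  simp only [dirInvY, dirPadY, h]

/-- outside the unit locus the local inverse is `0`. [cite: Balaban1985BackgroundPropagators, pp.408–409 (G′_□), bookkeeping] -/
theorem dirInvY_of_not_isUnit {P T : A} (h : ¬ IsUnit (dirPadY P T)) : dirInvY P T = 0 := by
  rw [dirInvY, Ring.inverse_non_unit _ h, mul_zero, zero_mul]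

variable {P : A} (hP : P * P = P)
include hP

/-- `P · (P T P + 1 − P) = P T P`. [cite: Balaban1985BackgroundPropagators, pp.408–409 (G′_□), bookkeeping] -/
theorem mul_dirPadY (T : A) : P * dirPadY P T = P * T * P := by
  rw [dirPadY, mul_add, mul_sub, mul_one, hP, sub_self, add_zero, ← mul_assoc, ← mul_assoc, hP]

/-- `(P T P + 1 − P) · P = P T P`. [cite: Balaban1985BackgroundPropagators, pp.408–409 (G′_□), bookkeeping] -/
theorem dirPadY_mul (T : A) : dirPadY P T * P = P * T * P := by
  rw [dirPadY, add_mul, sub_mul, one_mul, hP, sub_self, add_zero, mul_assoc, hP]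

/-- the padded compression of `1` is `1`. [cite: Balaban1985BackgroundPropagators, pp.408–409 (G′_□), bookkeeping] -/
theorem dirPadY_one : dirPadY P (1 : A) = 1 := by
  rw [dirPadY, mul_one, hP, add_sub_cancel]

/-- support on the left: `P · dirInvY = dirInvY`. [cite: Balaban1985BackgroundPropagators, pp.408–409 (G′_□), bookkeeping] -/
theorem mul_dirInvY (T : A) : P * dirInvY P T = dirInvY P T := by
  simp only [dirInvY, ← mul_assoc, hP]

/-- support on the right: `dirInvY · P = dirInvY`. [cite: Balaban1985BackgroundPropagators, pp.408–409 (G′_□), bookkeeping] -/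
theorem dirInvY_mul (T : A) : dirInvY P T * P = dirInvY P T := by
  rw [dirInvY, mul_assoc, hP]

/-- the complement kills it on the left: `(1 − P) · dirInvY = 0`. [cite: Balaban1985BackgroundPropagators, pp.408–409 (G′_□), bookkeeping] -/
theorem compl_mul_dirInvY (T : A) : (1 - P) * dirInvY P T = 0 := by
  rw [sub_mul, one_mul, mul_dirInvY hP, sub_self]

/-- and on the right: `dirInvY · (1 − P) = 0`. [cite: Balaban1985BackgroundPropagators, pp.408–409 (G′_□), bookkeeping] -/
theorem dirInvY_mul_compl (T : A) : dirInvY P T * (1 - P) = 0 := by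
  rw [mul_sub, mul_one, dirInvY_mul hP, sub_self]

/-- ★ **right inverse on the range of `P`**: `(P T P) · dirInvY P T = P` when the padded compression is a unit.
[cite: Balaban1985BackgroundPropagators, pp.408–409 (G′_□), (3.25) p.394] -/
theorem compr_mul_dirInvY {T : A} (hU : IsUnit (dirPadY P T)) : P * T * P * dirInvY P T = P := by
  simp only [dirInvY, ← mul_assoc]
  rw [mul_assoc (P * T) P P, hP, ← mul_dirPadY hP T, mul_assoc P (dirPadY P T) (Ring.inverse (dirPadY P T)),
    Ring.mul_inverse_cancel _ hU, mul_one, hP]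

/-- ★ **left inverse on the range of `P`**: `dirInvY P T · (P T P) = P` when the padded compression is a unit.
[cite: Balaban1985BackgroundPropagators, pp.408–409 (G′_□), (3.25) p.394] -/
theorem dirInvY_mul_compr {T : A} (hU : IsUnit (dirPadY P T)) : dirInvY P T * (P * T * P) = P := by
  simp only [dirInvY, ← mul_assoc]
  rw [mul_assoc (P * Ring.inverse (dirPadY P T)) P P, hP, mul_assoc (P * Ring.inverse (dirPadY P T)) P T,
    mul_assoc (P * Ring.inverse (dirPadY P T)) (P * T) P, ← dirPadY_mul hP T, ← mul_assoc, mul_assoc P (Ring.inverse (dirPadY P T)) (dirPadY P T),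
    Ring.inverse_mul_cancel _ hU, mul_one, hP]

/-- `T · dirInvY` seen from the range of `P`: `P T · dirInvY P T = P` (since `dirInvY = P · dirInvY`). [cite: Balaban1985BackgroundPropagators, pp.408–409 (G′_□), bookkeeping] -/
theorem P_mul_T_mul_dirInvY {T : A} (hU : IsUnit (dirPadY P T)) : P * T * dirInvY P T = P := by
  rw [← mul_dirInvY hP T, ← mul_assoc, compr_mul_dirInvY hP hU]

/-- at `T = 1`: `dirInvY P 1 = P`. [cite: Balaban1985BackgroundPropagators, pp.408–409 (G′_□), bookkeeping] -/
theorem dirInvY_one : dirInvY P (1 : A) = P := by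
  rw [dirInvY, dirPadY_one hP, Ring.inverse_one, mul_one, hP]

end Ring

/-- with the trivial projection the local inverse is the inverse: `dirInvY 1 T = T⁻¹`. [cite: Balaban1985BackgroundPropagators, (3.25) p.394, bookkeeping] -/
theorem dirInvY_one_left {A : Type} [Ring A] (T : A) : dirInvY 1 T = Ring.inverse T := by
  rw [dirInvY, dirPadY, one_mul, mul_one, sub_self, add_zero, one_mul, mul_one]

/-! ## §2 At def-Y's letters: the cube projection and `G′_□(U)` -/

section Letters

variable {𝔸 : Type} [NormedRing 𝔸] [NormedAlgebra ℂ 𝔸] [CompleteSpace 𝔸]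
variable {d ℓ : ℕ} {hd : 1 ≤ d + 1} {hL : Odd (ℓ + 1) ∧ 1 < ℓ + 1} {b₀ b₁ : ℝ}
variable (i : KIdx d ℓ hd hL b₀ b₁)

open Classical in
/-- the indicator of a site set (□̃ as a set of def-Y's sites). [cite: Balaban1985BackgroundPropagators, pp.408–409 (□̃ ⊃ □ of the cover), dictionary] -/
noncomputable def cubeIndY (D : Finset (SiteY i)) : SiteY i → ℝ := fun z => if z ∈ D then 1 else 0

omit [CompleteSpace 𝔸] in
open Classical in
/-- the indicator, squared, is itself. [cite: Balaban1985BackgroundPropagators, pp.408–409 (G′_□), bookkeeping] -/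
theorem cubeIndY_mul_self (D : Finset (SiteY i)) (z : SiteY i) : cubeIndY i D z * cubeIndY i D z = cubeIndY i D z := by
  unfold cubeIndY
  split_ifs <;> norm_num

/-- **the cube projection `P_□̃ = M_{𝟙_D}`**: restriction to the functions supported in `D`, as an idempotent of `End_ℂ(SiteY i → 𝔸)`.
[cite: Balaban1985BackgroundPropagators, pp.408–409 (G′_□), dictionary] -/
noncomputable def cubeProjY (D : Finset (SiteY i)) : Module.End ℂ (SiteY i → 𝔸) := cutMulY (cubeIndY i D)

omit [CompleteSpace 𝔸] in
open Classical in
/-- the projection, evaluated. [cite: Balaban1985BackgroundPropagators, pp.408–409 (G′_□), bookkeeping] -/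
theorem cubeProjY_apply (D : Finset (SiteY i)) (Λ : SiteY i → 𝔸) (z : SiteY i) :
    cubeProjY (𝔸 := 𝔸) i D Λ z = if z ∈ D then Λ z else 0 := by
  rw [cubeProjY, cutMulY_apply, cubeIndY]
  split_ifs <;> simp

omit [CompleteSpace 𝔸] in
/-- it is idempotent. [cite: Balaban1985BackgroundPropagators, pp.408–409 (G′_□), bookkeeping] -/
theorem cubeProjY_mul_cubeProjY (D : Finset (SiteY i)) : cubeProjY (𝔸 := 𝔸) i D * cubeProjY i D = cubeProjY i D := by
  rw [cubeProjY, cutMulY_mul]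
  exact congrArg cutMulY (funext fun z => cubeIndY_mul_self i D z)

omit [CompleteSpace 𝔸] in
/-- the whole lattice projects by the identity. [cite: Balaban1985BackgroundPropagators, pp.408–409 (G′_□), bookkeeping] -/
theorem cubeProjY_univ : cubeProjY (𝔸 := 𝔸) i Finset.univ = 1 := by
  rw [cubeProjY, ← cutMulY_one]
  exact congrArg cutMulY (funext fun z => by simp [cubeIndY])

omit [CompleteSpace 𝔸] in
/-- a cut-off supported in `D` absorbs the projection on the right: `M_h P_D = M_h`. [cite: Balaban1985BackgroundPropagators, (3.87) p.409 (supp h_□ ⊂ □̃), bookkeeping] -/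
theorem cutMulY_mul_cubeProjY (h : SiteY i → ℝ) {D : Finset (SiteY i)} (hD : ∀ z, h z ≠ 0 → z ∈ D) :
    cutMulY (𝔸 := 𝔸) h * cubeProjY i D = cutMulY h := by
  rw [cubeProjY, cutMulY_mul]
  refine congrArg cutMulY (funext fun z => ?_)
  by_cases hz : h z = 0
  · rw [hz, zero_mul]
  · simp [cubeIndY, hD z hz]

omit [CompleteSpace 𝔸] in
/-- and on the left: `P_D M_h = M_h`. [cite: Balaban1985BackgroundPropagators, (3.87) p.409, bookkeeping] -/
theorem cubeProjY_mul_cutMulY (h : SiteY i → ℝ) {D : Finset (SiteY i)} (hD : ∀ z, h z ≠ 0 → z ∈ D) :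
    cubeProjY (𝔸 := 𝔸) i D * cutMulY h = cutMulY h := by
  rw [cubeProjY, cutMulY_mul]
  refine congrArg cutMulY (funext fun z => ?_)
  by_cases hz : h z = 0
  · rw [hz, mul_zero]
  · simp [cubeIndY, hD z hz]

/-- the PADDED COMPRESSION of `Δ′_a(U)` to □̃ — the operator whose invertibility is the regime hypothesis of every local-inverse identity below.
[cite: Balaban1985BackgroundPropagators, pp.408–409 (G′_□), Thm 3.1 p.397] -/
noncomputable def padDeltaY (par : SiteParY 𝔸 i) (D : Finset (SiteY i)) (U : CfgY 𝔸 i) : Module.End ℂ (SiteY i → 𝔸) :=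
  dirPadY (cubeProjY i D) (deltaPrimeAY i par U)

/-- ★★ **THE GENUINE LOCAL CUBE INVERSE `G′_□(U)`** of pp. 408–409: the inverse of `Δ′_a(U)` compressed to the functions supported in `D = □̃`
(Dirichlet data outside), extended by `0` — `Ring.inverse` of the padded compression, sandwiched by the projection (def-Y's `GpY` convention:
the inverse where it exists, `0` elsewhere). [cite: Balaban1985BackgroundPropagators, pp.408–409 (G′_□(U) for the sequence {Ω_n(□)}), (3.87) p.409, (3.24)–(3.25) pp.394–395] -/
noncomputable def GsqY (par : SiteParY 𝔸 i) (D : Finset (SiteY i)) : SiteOpY 𝔸 i :=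
  fun U => dirInvY (cubeProjY i D) (deltaPrimeAY i par U)

/-- `G′_□(U)`, unfolded. [cite: Balaban1985BackgroundPropagators, pp.408–409 (G′_□), bookkeeping] -/
theorem GsqY_def (par : SiteParY 𝔸 i) (D : Finset (SiteY i)) (U : CfgY 𝔸 i) :
    GsqY i par D U = cubeProjY i D * Ring.inverse (padDeltaY i par D U) * cubeProjY i D := rfl

/-- `G′_□(U)` is supported in □̃ on the left: `P_D G′_□ = G′_□`. [cite: Balaban1985BackgroundPropagators, pp.408–409 (G′_□)] -/
theorem cubeProjY_mul_GsqY (par : SiteParY 𝔸 i) (D : Finset (SiteY i)) (U : CfgY 𝔸 i) :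
    cubeProjY i D * GsqY i par D U = GsqY i par D U :=
  mul_dirInvY (cubeProjY_mul_cubeProjY i D) _

/-- and on the right: `G′_□ P_D = G′_□`. [cite: Balaban1985BackgroundPropagators, pp.408–409 (G′_□)] -/
theorem GsqY_mul_cubeProjY (par : SiteParY 𝔸 i) (D : Finset (SiteY i)) (U : CfgY 𝔸 i) :
    GsqY i par D U * cubeProjY i D = GsqY i par D U :=
  dirInvY_mul (cubeProjY_mul_cubeProjY i D) _

/-- hence `G′_□(U)λ` vanishes outside □̃. [cite: Balaban1985BackgroundPropagators, pp.408–409 (G′_□)] -/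
theorem GsqY_apply_eq_zero (par : SiteParY 𝔸 i) {D : Finset (SiteY i)} (U : CfgY 𝔸 i) (Λ : SiteY i → 𝔸) {z : SiteY i} (hz : z ∉ D) :
    GsqY i par D U Λ z = 0 := by
  rw [← cubeProjY_mul_GsqY, Module.End.mul_apply, cubeProjY_apply, if_neg hz]

/-- and `G′_□(U)λ` depends on `λ` only inside □̃. [cite: Balaban1985BackgroundPropagators, pp.408–409 (G′_□)] -/
theorem GsqY_apply_congr (par : SiteParY 𝔸 i) {D : Finset (SiteY i)} (U : CfgY 𝔸 i) {Λ Λ' : SiteY i → 𝔸} (h : ∀ z ∈ D, Λ z = Λ' z) :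
    GsqY i par D U Λ = GsqY i par D U Λ' := by
  have hP : cubeProjY (𝔸 := 𝔸) i D Λ = cubeProjY i D Λ' := funext fun z => by
    rw [cubeProjY_apply, cubeProjY_apply]
    split_ifs with hz
    · exact h z hz
    · rfl
  rw [← GsqY_mul_cubeProjY, Module.End.mul_apply, Module.End.mul_apply, hP]

/-- outside the regime (padded compression not a unit) `G′_□(U) = 0`. [cite: Balaban1985BackgroundPropagators, pp.408–409 (G′_□), bookkeeping] -/
theorem GsqY_of_not_isUnit (par : SiteParY 𝔸 i) {D : Finset (SiteY i)} {U : CfgY 𝔸 i} (h : ¬ IsUnit (padDeltaY i par D U)) :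
    GsqY i par D U = 0 :=
  dirInvY_of_not_isUnit h

/-- ★ **`G′_□(U)` inverts the compressed `Δ′_a(U)` on □̃ (right)**: `(P_D Δ′_a(U) P_D) G′_□(U) = P_D`. [cite: Balaban1985BackgroundPropagators, pp.408–409 (G′_□), (3.25) p.394] -/
theorem compr_deltaPrimeAY_mul_GsqY (par : SiteParY 𝔸 i) {D : Finset (SiteY i)} {U : CfgY 𝔸 i} (hU : IsUnit (padDeltaY i par D U)) :
    cubeProjY i D * deltaPrimeAY i par U * cubeProjY i D * GsqY i par D U = cubeProjY i D :=
  compr_mul_dirInvY (cubeProjY_mul_cubeProjY i D) hU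

/-- ★ **(left)**: `G′_□(U) (P_D Δ′_a(U) P_D) = P_D`. [cite: Balaban1985BackgroundPropagators, pp.408–409 (G′_□), (3.25) p.394] -/
theorem GsqY_mul_compr_deltaPrimeAY (par : SiteParY 𝔸 i) {D : Finset (SiteY i)} {U : CfgY 𝔸 i} (hU : IsUnit (padDeltaY i par D U)) :
    GsqY i par D U * (cubeProjY i D * deltaPrimeAY i par U * cubeProjY i D) = cubeProjY i D :=
  dirInvY_mul_compr (cubeProjY_mul_cubeProjY i D) hU

/-- `P_D Δ′_a(U) G′_□(U) = P_D`. [cite: Balaban1985BackgroundPropagators, pp.408–409 (G′_□), bookkeeping] -/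
theorem cubeProjY_mul_deltaPrimeAY_mul_GsqY (par : SiteParY 𝔸 i) {D : Finset (SiteY i)} {U : CfgY 𝔸 i} (hU : IsUnit (padDeltaY i par D U)) :
    cubeProjY i D * deltaPrimeAY i par U * GsqY i par D U = cubeProjY i D :=
  P_mul_T_mul_dirInvY (cubeProjY_mul_cubeProjY i D) hU

/-- ★★ **THE LOCAL-INVERSE PROPERTY OF (3.87)–(3.88) DISCHARGED**: for every cut-off `h` supported in □̃, `h Δ′_a(U) G′_□(U) h = h²` — the hypothesis
`hloc` of `B9Thm37CubeCoverCommutators.eq388_deltaPrimeAY`, from invertibility of the compressed operator alone.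
[cite: Balaban1985BackgroundPropagators, (3.87)–(3.88) p.409, pp.408–409 (G′_□)] -/
theorem cutMulY_deltaPrimeAY_GsqY_cutMulY (par : SiteParY 𝔸 i) {D : Finset (SiteY i)} {U : CfgY 𝔸 i} (hU : IsUnit (padDeltaY i par D U))
    (h : SiteY i → ℝ) (hD : ∀ z, h z ≠ 0 → z ∈ D) :
    cutMulY h * deltaPrimeAY i par U * GsqY i par D U * cutMulY h = cutMulY h * cutMulY h := by
  rw [← cutMulY_mul_cubeProjY i h hD, mul_assoc (cutMulY h) (cubeProjY i D) (deltaPrimeAY i par U),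
    mul_assoc (cutMulY h) (cubeProjY i D * deltaPrimeAY i par U) (GsqY i par D U), cubeProjY_mul_deltaPrimeAY_mul_GsqY i par hU,
    mul_assoc (cutMulY h) (cubeProjY i D) (cutMulY h * cubeProjY i D), ← mul_assoc (cubeProjY i D) (cutMulY h) (cubeProjY i D),
    cubeProjY_mul_cutMulY i h hD]

/-- ★ **(3.88) AT THE GENUINE LOCAL INVERSES**: with `G′₀ := Σ_c h_c G′_{□_c}(U) h_c` over any real family with `Σ_c h_c² = 1`, each `h_c` supported in
its cube `D c`, and every compressed `Δ′_a(U)` invertible, `Δ′_a(U) G′₀ = 1 − Σ_c K(h_c) G′_{□_c}(U) h_c`.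
[cite: Balaban1985BackgroundPropagators, (3.87)–(3.88) p.409] -/
theorem eq388_GsqY (par : SiteParY 𝔸 i) (U : CfgY 𝔸 i) {ι : Type} [Fintype ι] (hf : ι → SiteY i → ℝ) (hsq : ∀ z, ∑ c, hf c z ^ 2 = 1)
    (D : ι → Finset (SiteY i)) (hD : ∀ c z, hf c z ≠ 0 → z ∈ D c) (hU : ∀ c, IsUnit (padDeltaY i par (D c) U)) :
    deltaPrimeAY i par U * (∑ c, cutMulY (hf c) * GsqY i par (D c) U * cutMulY (hf c))
      = 1 - ∑ c, KhY i par (hf c) U * GsqY i par (D c) U * cutMulY (hf c) :=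
  eq388_deltaPrimeAY i par U hf hsq (fun c => GsqY i par (D c) U) fun c => cutMulY_deltaPrimeAY_GsqY_cutMulY i par (hU c) (hf c) (hD c)

/-- ★ **(3.90) as a fixed point AT THE GENUINE LOCAL INVERSES**: any left inverse `G′` of `Δ′_a(U)` equals `G′₀ + G′ R′` with `R′ = Σ_c K(h_c) G′_{□_c}(U) h_c`.
[cite: Balaban1985BackgroundPropagators, (3.90) p.409] -/
theorem fixedPoint388_GsqY (par : SiteParY 𝔸 i) (U : CfgY 𝔸 i) {ι : Type} [Fintype ι] (hf : ι → SiteY i → ℝ) (hsq : ∀ z, ∑ c, hf c z ^ 2 = 1)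
    (D : ι → Finset (SiteY i)) (hD : ∀ c z, hf c z ≠ 0 → z ∈ D c) (hU : ∀ c, IsUnit (padDeltaY i par (D c) U))
    {G' : Module.End ℂ (SiteY i → 𝔸)} (hinv : G' * deltaPrimeAY i par U = 1) :
    G' = (∑ c, cutMulY (hf c) * GsqY i par (D c) U * cutMulY (hf c)) + G' * ∑ c, KhY i par (hf c) U * GsqY i par (D c) U * cutMulY (hf c) :=
  fixedPoint388_deltaPrimeAY i par U hf hsq (fun c => GsqY i par (D c) U)
    (fun c => cutMulY_deltaPrimeAY_GsqY_cutMulY i par (hU c) (hf c) (hD c)) hinv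

/-- in particular with def-Y's genuine `G′(U) = GpY` in the regime where `Δ′_a(U)` is invertible. [cite: Balaban1985BackgroundPropagators, (3.90) p.409, (3.25) p.394] -/
theorem GpY_eq_fixedPoint388 (par : SiteParY 𝔸 i) (U : CfgY 𝔸 i) {ι : Type} [Fintype ι] (hf : ι → SiteY i → ℝ) (hsq : ∀ z, ∑ c, hf c z ^ 2 = 1)
    (D : ι → Finset (SiteY i)) (hD : ∀ c z, hf c z ≠ 0 → z ∈ D c) (hU : ∀ c, IsUnit (padDeltaY i par (D c) U))
    (hUg : IsUnit (deltaPrimeAY i par U)) :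
    GpY i par U = (∑ c, cutMulY (hf c) * GsqY i par (D c) U * cutMulY (hf c)) + GpY i par U * ∑ c, KhY i par (hf c) U * GsqY i par (D c) U * cutMulY (hf c) :=
  fixedPoint388_GsqY i par U hf hsq D hD hU (GpY_mul_deltaPrimeAY i par U hUg)

/-- ★ **LOCALITY IN `U` (the `Locality.gsq` clause, algebraic half)**: `G′_□(U)` depends on the configuration only through the compression
`P_D Δ′_a(U) P_D` — two configurations whose compressed operators agree have the same `G′_□`. (The support statement «`P_D Δ′_a(U) P_D` reads `U`
only on the bonds of □̃» is the other half.) [cite: Balaban1985BackgroundPropagators, p.410 L14–15 («G′_□ depends on U restricted to Ω₀(□) ⊂ □̃⁵»), pp.408–409 (G′_□)] -/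
theorem GsqY_congr (par : SiteParY 𝔸 i) (D : Finset (SiteY i)) {U U' : CfgY 𝔸 i}
    (h : cubeProjY i D * deltaPrimeAY i par U * cubeProjY i D = cubeProjY i D * deltaPrimeAY i par U' * cubeProjY i D) :
    GsqY i par D U = GsqY i par D U' :=
  dirInvY_congr h

omit [CompleteSpace 𝔸] in
/-- pointwise-to-operator bridge for compressions: two operators that agree ON □̃ for every input SUPPORTED IN □̃ have the same compression
`P_D T P_D`. [cite: Balaban1985BackgroundPropagators, pp.408–409 (G′_□), bookkeeping] -/
theorem compr_congr_of_apply (D : Finset (SiteY i)) {T T' : Module.End ℂ (SiteY i → 𝔸)}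
    (h : ∀ Λ : SiteY i → 𝔸, (∀ z, z ∉ D → Λ z = 0) → ∀ z ∈ D, T Λ z = T' Λ z) :
    cubeProjY i D * T * cubeProjY i D = cubeProjY i D * T' * cubeProjY i D := by
  refine LinearMap.ext fun Λ => funext fun z => ?_
  simp only [Module.End.mul_apply]
  rw [cubeProjY_apply, cubeProjY_apply]
  split_ifs with hz
  · exact h _ (fun w hw => by rw [cubeProjY_apply, if_neg hw]) z hz
  · rfl

/-- ★ **LOCALITY IN `U`, pointwise form** (what FILE A-1's support lemma feeds): if `Δ′_a(U)` and `Δ′_a(U′)` agree on □̃ for every input supported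
in □̃, then `G′_□(U) = G′_□(U′)`. [cite: Balaban1985BackgroundPropagators, p.410 L14–15 («G′_□ depends on U restricted to Ω₀(□) ⊂ □̃⁵»), pp.408–409 (G′_□)] -/
theorem GsqY_congr_of_apply (par : SiteParY 𝔸 i) (D : Finset (SiteY i)) {U U' : CfgY 𝔸 i}
    (h : ∀ Λ : SiteY i → 𝔸, (∀ z, z ∉ D → Λ z = 0) → ∀ z ∈ D, deltaPrimeAY i par U Λ z = deltaPrimeAY i par U' Λ z) :
    GsqY i par D U = GsqY i par D U' :=
  GsqY_congr i par D (compr_congr_of_apply i D h)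

/-- the padded compression under the same congruence. [cite: Balaban1985BackgroundPropagators, pp.408–409 (G′_□), bookkeeping] -/
theorem padDeltaY_congr (par : SiteParY 𝔸 i) (D : Finset (SiteY i)) {U U' : CfgY 𝔸 i}
    (h : cubeProjY i D * deltaPrimeAY i par U * cubeProjY i D = cubeProjY i D * deltaPrimeAY i par U' * cubeProjY i D) :
    padDeltaY i par D U = padDeltaY i par D U' := by
  rw [padDeltaY, padDeltaY, dirPadY, dirPadY, h]

/-- ★ **the whole-lattice face**: with `D = univ` the local inverse IS def-Y's genuine letter `G′(U) = GpY`. [cite: Balaban1985BackgroundPropagators, (3.25) p.394, pp.408–409 (G′_□)] -/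
theorem GsqY_univ (par : SiteParY 𝔸 i) : GsqY i par Finset.univ = GpY i par := by
  funext U
  rw [GsqY, cubeProjY_univ, dirInvY_one_left]
  rfl

/-- and its regime hypothesis is invertibility of `Δ′_a(U)` itself. [cite: Balaban1985BackgroundPropagators, (3.25) p.394, bookkeeping] -/
theorem padDeltaY_univ (par : SiteParY 𝔸 i) (U : CfgY 𝔸 i) : padDeltaY i par Finset.univ U = deltaPrimeAY i par U := by
  rw [padDeltaY, cubeProjY_univ, dirPadY, one_mul, mul_one, sub_self, add_zero]


/-! ## §3 Locality in `U` — the support half, for an abstract transporter letter `par` -/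

/-- the covariant Laplacian at `z` reads the configuration only on the `2(d+1)` bonds at `z`: `U_μ(z)` and `U_μ(z − e_μ)`.
[cite: Balaban1985BackgroundPropagators, (3.23) p.394, (3.3) p.390, bookkeeping] -/
theorem lapS_congr_of_agree {U U' : CfgY 𝔸 i} (Φ : SiteY i → 𝔸) (z : SiteY i)
    (hU : ∀ μ, UboxY i U μ z = UboxY i U' μ z ∧ UboxY i U μ ((shiftY i μ).symm z) = UboxY i U' μ ((shiftY i μ).symm z)) :
    lapS i U Φ z = lapS i U' Φ z := by
  simp only [lapS, cdsS, cdS, B9Eq39Adjoint.covD, B9Eq39Adjoint.covDstar]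
  refine Finset.sum_congr rfl fun μ _ => ?_
  rw [(hU μ).1, (hU μ).2]

/-- ★ **`Δ′_a(U)` at `z` reads `U` only at the bonds of `z` and through the averaging transporters `U(Γ_{z,c})U(Γ_{c,w})` of the block of `z`**:
two configurations agreeing there give the same `(Δ′_a λ)(z)` for every `λ`. [cite: Balaban1985BackgroundPropagators, (3.24) p.394, (3.19) p.393] -/
theorem deltaPrimeAY_apply_congr_of_agree (par : SiteParY 𝔸 i) {U U' : CfgY 𝔸 i} (Λ : SiteY i → 𝔸) (z : SiteY i)
    (hU : ∀ μ, UboxY i U μ z = UboxY i U' μ z ∧ UboxY i U μ ((shiftY i μ).symm z) = UboxY i U' μ ((shiftY i μ).symm z))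
    (hpar : ∀ w, avgCoeffY i z w ≠ 0 → avgTrY i par U z w = avgTrY i par U' z w) :
    deltaPrimeAY i par U Λ z = deltaPrimeAY i par U' Λ z := by
  rw [deltaPrimeAY_apply, deltaPrimeAY_apply, lapS_congr_of_agree i Λ z hU]
  congr 1
  refine Finset.sum_congr rfl fun w _ => ?_
  by_cases hw : avgCoeffY i z w = 0
  · rw [hw, Complex.ofReal_zero, zero_smul, zero_smul]
  · rw [hpar w hw]

/-- ★★ **THE `Locality.gsq` SHAPE FOR `G′_□(U)`**: if `U` and `U′` agree on the bonds at the sites of □̃ and their block transporters agree on the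
averaging pairs issuing from □̃, then `G′_□(U) = G′_□(U′)` (print: `G′_□` «localized in □̃⁵»). For def-Y's genuine taxi transporter `parSY` the
transporter clause is agreement of `U` on the blocks meeting □̃ (FILE A-1). [cite: Balaban1985BackgroundPropagators, p.410 L14–15, pp.408–409] -/
theorem GsqY_congr_of_agree (par : SiteParY 𝔸 i) (D : Finset (SiteY i)) {U U' : CfgY 𝔸 i}
    (hU : ∀ z ∈ D, ∀ μ, UboxY i U μ z = UboxY i U' μ z ∧ UboxY i U μ ((shiftY i μ).symm z) = UboxY i U' μ ((shiftY i μ).symm z))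
    (hpar : ∀ z ∈ D, ∀ w, avgCoeffY i z w ≠ 0 → avgTrY i par U z w = avgTrY i par U' z w) :
    GsqY i par D U = GsqY i par D U' :=
  GsqY_congr_of_apply i par D fun Λ _ z hz => deltaPrimeAY_apply_congr_of_agree i par Λ z (hU z hz) (hpar z hz)

/-- and the regime object `padDeltaY` is local in the same sense. [cite: Balaban1985BackgroundPropagators, p.410 L14–15, bookkeeping] -/
theorem padDeltaY_congr_of_agree (par : SiteParY 𝔸 i) (D : Finset (SiteY i)) {U U' : CfgY 𝔸 i}
    (hU : ∀ z ∈ D, ∀ μ, UboxY i U μ z = UboxY i U' μ z ∧ UboxY i U μ ((shiftY i μ).symm z) = UboxY i U' μ ((shiftY i μ).symm z))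
    (hpar : ∀ z ∈ D, ∀ w, avgCoeffY i z w ≠ 0 → avgTrY i par U z w = avgTrY i par U' z w) :
    padDeltaY i par D U = padDeltaY i par D U' :=
  padDeltaY_congr i par D (compr_congr_of_apply i D fun Λ _ z hz => deltaPrimeAY_apply_congr_of_agree i par Λ z (hU z hz) (hpar z hz))

end Letters

end Literature.MathematicalPhysics.QuantumFieldTheory.Balaban1983to89.Node00.OpsYLocalInverse
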